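import Summits.BirchSwinnertonDyer.Rank1Residual.X11b.AnticyclotomicDualPair
import Literature.NumberTheory.EllipticCurves.SelmerInftyTorsionFiniteProofs
import Literature.NumberTheory.EllipticCurves.ZpExtensionUnramifiedProofs
import HarnessLib

/-!
# X11b, route R1 — `Sel_𝔭^Σ(K_∞, E[p^∞])[𝔪]` is FINITE for finite `Σ`
# (the input of Nakayama's lemma for `X_ac^Σ(E[p^∞])`; Castella's "easily shown")

HONEST FRAMING (cell `b2b-bsdres`, run/shared/lean/b2b/bsd-rank1-residual/, verbatim in every
file): the goal of the cell is to DELETE the COMBINATION-SHAPED residual classes of the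
Birch–Swinnerton-Dyer formula for ALL analytic-rank `≤ 1` elliptic curves over `ℚ` — "full BSD
formula for every rank `≤ 1` curve in class `C`" assembled STRICTLY from published theorems — so
that the rank-`≤ 1` remainder becomes exactly the CONSTRUCTION-SHAPED classes, which are TYPED
(missing-input `Prop`s), NOT attempted. This is not "finishing BSD". Sub-cell
`b2b-bsdres-multr1-p1` (X11b, route R1 = Castella 2018 Thm. A re-proved along the author's
erratum); a RESEARCH ROUTE; no claim beyond the stated class; X11b stays CONSTRUCTION-SHAPED;
nothing here changes a label; no named fact is minted (theorems only; no `sorry`).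

## Content

Castella, Camb. J. Math. 6 (2018) §2.1 (arXiv:1704.06608 p. 5): "`X_ac^Σ(E[p^∞]) :=
Hom_{ℤ_p}(Sel_𝔭^Σ(K_∞, E[p^∞]), ℚ_p/ℤ_p)`, which is easily shown to be a finitely generated
`Λ`-module." By the tree's PROVED Nakayama lemma for Pontryagin duals
(`IwasawaDual.IsDualPair.module_finite`; for `X_ac^Σ`: `XAc.module_finite_of_finite`,
`AnticyclotomicDualPair.lean`) finite generation follows from the finiteness of
`Sel_𝔭^Σ(K_∞, E[p^∞])[𝔪] = {s | p s = 0, conj_γ s = s}`, `𝔪 = (p, T)`. This file PROVES that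
finiteness for every elliptic curve `E/K` over a number field, every `ℤ_p`-extension `κ` (so in
particular the anticyclotomic one), every topological generator `γ`, every distinguished prime `𝔭`
and every FINITE set `Σ` of places — Greenberg's argument (LNM 1716, §1 p. 60: "`X/𝔪X` is finite …
This can actually be proved for any prime `p`, with no restriction on the reduction type of `E`")
exactly as the tree runs it for the classical Selmer group in `SelmerInftyTorsionFiniteProofs`
(steps (A) Kummer lift, (B) unramifiedness, (C) descent into the finite group `H¹(G_K, E[p]; S')`,
Silverman X.4.3), with ONE changed step:

* **(B′) `resOfLe_eq_zero_of_mem_selmerOver`** — classes of `H¹(K̄^H, E[p])` whose image in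
  `H¹(K̄^H, E[p^∞])` lies in Castella's `Sel_𝔭^Σ(K̄^H, E[p^∞])` are UNRAMIFIED at every prime `𝔓` of
  `\bar ℤ_K` with `I_𝔓 ≤ H` above a place `v ∉ Σ`, `v ∤ p`, of good reduction. Castella's condition
  off `p` outside `Σ` is local TRIVIALITY in `H¹(L_w, E[p^∞])` (stronger than the Kummer condition of
  (B)): the `E[p^∞]`-valued cocycle is a coboundary `δ ↦ δ m − m` on the decomposition group, and an
  inertia element at a good place `v ∤ p` fixes the `p^k`-torsion point `m` (the reduction step
  `smul_localPoints_eq_of_mem_inertia_holds`, AEC VIII.1.4 / VII.3.1(b), transported along the chosen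
  embedding `K̄ → K̄_v` and the local–global inertia compatibility
  `exists_mem_inertia_apply_eq_holds`, Neukirch II (9.6)); hence the `E[p]`-valued cocycle vanishes
  on `I_𝔓`.
* **(C′) `finite_setOf_selmerAc_pTorsion_conjH1_eq`** — the assembly of
  `WeierstrassCurve.finite_setOf_selmerInfty_pTorsion_conjH1_eq` with (B′) in place of (B) and the
  finite set `S' = {bad} ∪ {v ∣ p} ∪ Σ`; hypothesis: `κ` unramified outside `p` (`hIκ`).
* **`finite_selmerAc_pTorsion_invariants`** — UNCONDITIONAL form: `hIκ` is the tree's PROVED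
  `ZpExtension.inertia_le_kerSubgroup_holds` (Washington Prop. 13.2 without class field theory,
  `ZpExtensionUnramifiedProofs`).
* **`XAc.module_finite`** — CASTELLA'S "EASILY SHOWN" AS A THEOREM: for every elliptic curve `E/K`
  over a number field, every `ℤ_p`-extension `κ`, topological generator `γ`, prime `𝔭` and FINITE
  `Σ`, the constructed `Λ`-module `X_ac^Σ(E[p^∞]) = XAc W p κ 𝔭 S γ` is finitely generated
  (`Module.Finite (IwasawaAlgebra p)`), by `XAc.module_finite_of_finite` (Nakayama,
  `AnticyclotomicDualPair.lean`); `XAc.module_finite_empty` is the case `Σ = ∅` of route R1. This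
  discharges the hypothesis `hfg : Module.Finite Λ (X_ac^Σ(E[p^∞]))` displayed in
  `XAc.isTorsion_and_charIdeal_eq_of_congruences_printed` (`AnticyclotomicLinks.lean`).

References: [Castella2018] §2.1 (arXiv:1704.06608 p. 5); [GreenbergLNM1716] §1 p. 60;
[SilvermanAEC2009] X.§4 (Lemma 4.3, Cor. 4.4), VIII.§1; [Washington1997] Prop. 13.2;
[NeukirchANT1999] II (9.6).
-/

open CategoryTheory Literature.NumberTheory.EllipticCurves Literature.NumberTheory.GaloisRepresentations
open Literature.NumberTheory.EllipticCurves.GreenbergSelmer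

universe u

noncomputable section

namespace Summit.BirchSwinnertonDyer.Rank1Residual.X11b.AcSelmer

open scoped Classical AddSubgroup Pointwise
open NumberField IsDedekindDomain Field

variable {K : Type u} [Field K] [NumberField K] (W : WeierstrassCurve K) (p : ℕ)

/-! ## (B′) Castella's Selmer classes are unramified outside `Σ ∪ {bad} ∪ {v ∣ p}` -/

section Unramified

variable {W p}
variable {H : Subgroup (absoluteGaloisGroup K)} [H.Normal]

/-- **(B′) Classes of `Sel_𝔭^Σ(K̄^H, E[p^∞])` coming from `H¹(K̄^H, E[p])` are unramified outside
`Σ ∪ {bad} ∪ {v ∣ p}`.** If the image in `H¹(H, E[p^∞])` of `y ∈ H¹(H, E[p])` lies in Castella's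
`selmerOver H E[p^∞] p 𝔭 Σ`, then `y` restricts to `0` in `H¹(I_𝔓, E[p])` for every inertia group
`I_𝔓 ≤ H` of a prime `𝔓` of `\bar ℤ_K` above a place `v ∉ Σ`, `v ∤ p`, of good reduction. Proof:
transport `𝔓 = g • 𝔓₀` to the prime `𝔓₀` cut out by the chosen embedding `ι₀ : K̄ → K̄_v`
(`exists_smul_eq_of_mem_primesAbove_holds`); Castella's condition at `v` for `conj_{g⁻¹}` (local
TRIVIALITY on `H ⊓ D_v`, `awayKer`) says `g⁻¹ φ(g δ g⁻¹) = δ m − m` on `H ⊓ D_v` for some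
`m ∈ E[p^∞]`, `p^k m = 0`; for `τ ∈ I_𝔓`, `δ = g⁻¹ τ g ∈ I_{𝔓₀} ≤ D_v` lifts to a local inertia element
`σ'` (`exists_mem_inertia_apply_eq_holds`, Neukirch II (9.6)) and `p^k (σ' P − P) = 0` for
`P = ι₀(m)` forces `σ' P = P` (`smul_localPoints_eq_of_mem_inertia_holds`, AEC VIII.1.4), i.e.
`δ m = m`, so `φ(τ) = 0`. Compare the tree's (B) `WeierstrassCurve.resOfLe_eq_zero_of_mem_selmerGroupOver`
for the Kummer condition. [cite: SilvermanAEC2009, Cor. X.4.4 (proof of Thm. X.4.2(b))] [cite: Castella2018, Def. 2.2 (arXiv:1704.06608 p. 5)] -/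
theorem resOfLe_eq_zero_of_mem_selmerOver [W.IsElliptic] {𝔭 : HeightOneSpectrum (𝓞 K)}
    {S : Set (HeightOneSpectrum (𝓞 K))}
    {y : Literature.NumberTheory.EllipticCurves.subgroupH1 H (W.geomTorsion (p : ℤ))}
    (hy : W.torsionToPrimaryH1Sub p H y ∈ selmerOver H (W.geomPrimaryTorsion p) p 𝔭 S)
    {v : HeightOneSpectrum (𝓞 K)} (hv : v ∉ W.badPlaces (𝓞 K)) (hpv : (p : 𝓞 K) ∉ v.asIdeal)
    (hvS : v ∉ S) {𝔓 : Ideal (absIntegers (𝓞 K) K)} (h𝔓 : 𝔓 ∈ v.primesAbove)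
    (hle : 𝔓.inertia (absoluteGaloisGroup K) ≤ H) :
    Literature.NumberTheory.EllipticCurves.resOfLe (W.geomTorsion (p : ℤ)) hle y = 0 := by
  obtain ⟨φ, rfl⟩ := oneCocycleClass_surjective _ y
  -- base prime `𝔓₀` from the chosen embedding and a local prime `𝔐`, and `g` with `g • 𝔓₀ = 𝔓`
  obtain ⟨𝔐, h𝔐⟩ := v.localPrimesAbove_nonempty
  set ι₀ := closureEmb (K := K) (v.adicCompletion K) with hι₀
  obtain ⟨g, hg⟩ := HeightOneSpectrum.exists_smul_eq_of_mem_primesAbove_holds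
    (HeightOneSpectrum.primeBelow_mem_primesAbove (ι := ι₀) h𝔐) h𝔓
  -- Castella's condition at `v` (off `p`, outside `Σ`), conjugated by `g⁻¹`
  have hsel := ((mem_selmerOver_iff _).mp hy).1 v hpv hvS g⁻¹
  rw [W.torsionToPrimaryH1Sub_oneCocycleClass p H] at hsel
  -- cocycle-level form of `conj_{g⁻¹}`
  have hc : ∀ (x : H) (m : W.geomPrimaryTorsion p),
      DistribSMul.toAddMonoidHom _ g⁻¹ (subgroupConj H g⁻¹ x • m) =
        x • DistribSMul.toAddMonoidHom _ g⁻¹ m := fun x m ↦ by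
    simp only [DistribSMul.toAddMonoidHom_apply, Subgroup.smul_def, subgroupConj_apply_coe,
      smul_smul, mul_assoc, mul_inv_cancel_left]
  set ψ := contOneCocycles.push (AddSubgroup.inclusion (W.geomTorsion_le_geomPrimaryTorsion p))
    (fun _ _ ↦ rfl) φ with hψ
  set ψg := contOneCocycles.pullback (subgroupConj H g⁻¹)
    (resHomOfEquivariant (subgroupConj H g⁻¹) (DistribSMul.toAddMonoidHom _ g⁻¹) hc) ψ with hψg
  have hconj : W.conjH1 p H g⁻¹ (oneCocycleClass _ ψ) = oneCocycleClass _ ψg :=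
    map_oneCocycleClass _ _ _ ψ
  rw [hconj, awayKer, AddMonoidHom.mem_ker] at hsel
  -- the local condition: restriction to `H ⊓ D_v` is the class of a coboundary
  have hDv : H ⊓ decomp v ≤ H := inf_le_left
  have hres : Literature.NumberTheory.EllipticCurves.resOfLe (W.geomPrimaryTorsion p) hDv
      (oneCocycleClass _ ψg) = oneCocycleClass _
      (contOneCocycles.pullback (subgroupInclusion hDv)
        (resHomOfEquivariant (subgroupInclusion hDv) (AddMonoidHom.id (W.geomPrimaryTorsion p))
          (fun _ _ ↦ rfl)) ψg) :=
    map_oneCocycleClass _ _ _ ψg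
  rw [hres, oneCocycleClass_eq_zero_iff] at hsel
  obtain ⟨m, hm⟩ := hsel
  -- `m ∈ E[p^∞]`: `p^k m = 0`
  obtain ⟨k, hk⟩ := (m : W.geomPrimaryTorsion p).2
  -- goal: `φ` vanishes on `I_𝔓`
  have hvan : ∀ τ : absoluteGaloisGroup K, ∀ hτ : τ ∈ 𝔓.inertia (absoluteGaloisGroup K),
      φ.1 ⟨τ, hle hτ⟩ = 0 := by
    intro τ hτ
    -- `σ₀ = g⁻¹ τ g ∈ I_{𝔓₀}` and a local `σ'` above it
    have hσ₀ : g⁻¹ * τ * g ∈ (v.primeBelow ι₀ 𝔐).inertia (absoluteGaloisGroup K) := by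
      rw [← WeierstrassCurve.mem_inertia_smul_iff, hg]; exact hτ
    obtain ⟨σ', hσ'I, hσ'⟩ :=
      HeightOneSpectrum.exists_mem_inertia_apply_eq_holds v ι₀ h𝔐 hσ₀
    have hresσ : resGalOfEmb ι₀ σ' = g⁻¹ * τ * g := resGalOfEmb_eq_of_apply_eq ι₀ hσ'
    have hσ₀H : g⁻¹ * τ * g ∈ H := by
      have := Subgroup.Normal.conj_mem inferInstance τ (hle hτ) g⁻¹
      simpa using this
    have hσ₀D : g⁻¹ * τ * g ∈ decomp v := by
      rw [mem_decomp_iff]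
      exact ⟨σ', hresσ⟩
    -- evaluate the coboundary identity at `δ = g⁻¹ τ g ∈ H ⊓ D_v`
    have key := hm ⟨g⁻¹ * τ * g, Subgroup.mem_inf.mpr ⟨hσ₀H, hσ₀D⟩⟩
    have e0 : subgroupConj H g⁻¹ (subgroupInclusion hDv
        ⟨g⁻¹ * τ * g, Subgroup.mem_inf.mpr ⟨hσ₀H, hσ₀D⟩⟩) = ⟨τ, hle hτ⟩ :=
      Subtype.ext (by
        rw [subgroupConj_apply_coe, subgroupInclusion_apply_coe, inv_inv]
        group)
    have e1 : (contOneCocycles.pullback (subgroupInclusion hDv)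
        (resHomOfEquivariant (subgroupInclusion hDv) (AddMonoidHom.id (W.geomPrimaryTorsion p))
          (fun _ _ ↦ rfl)) ψg).1 ⟨g⁻¹ * τ * g, Subgroup.mem_inf.mpr ⟨hσ₀H, hσ₀D⟩⟩ =
        g⁻¹ • AddSubgroup.inclusion (W.geomTorsion_le_geomPrimaryTorsion p) (φ.1 ⟨τ, hle hτ⟩) := by
      rw [contOneCocycles.pullback_apply, hψg, contOneCocycles.pullback_apply, e0]
      rfl
    rw [e1] at key
    change g⁻¹ • _ = (⟨g⁻¹ * τ * g, Subgroup.mem_inf.mpr ⟨hσ₀H, hσ₀D⟩⟩ : ↥(H ⊓ decomp v)) • m - m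
      at key
    rw [Subgroup.mk_smul] at key
    -- `key : g⁻¹ • φ(τ) = (g⁻¹ τ g) • m - m`; the right side vanishes: inertia at a good `v ∤ p`
    -- fixes the `p^k`-torsion point `m` (reduction step along `ι₀`)
    have hpkv : (((p ^ k : ℕ) : ℤ) : 𝓞 K) ∉ v.asIdeal := by
      rw [Int.cast_natCast, Nat.cast_pow]
      exact fun h ↦ hpv (v.isPrime.mem_of_pow_mem _ h)
    have hP : σ' • pointsMapOfEmb W ι₀ ((m : W.geomPrimaryTorsion p) : W.geomPoints) =
        pointsMapOfEmb W ι₀ ((m : W.geomPrimaryTorsion p) : W.geomPoints) := by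
      refine W.smul_localPoints_eq_of_mem_inertia_holds v hv hpkv h𝔐 hσ'I ?_
      rw [natCast_zsmul, ← pointsMapOfEmb_smul, hresσ, ← map_sub, ← map_nsmul, smul_sub,
        smul_comm, hk, smul_zero, sub_self, map_zero]
    rw [← pointsMapOfEmb_smul, hresσ] at hP
    have hfixm : (g⁻¹ * τ * g) • m = m := Subtype.ext ((pointsMapOfEmb_injective W ι₀) hP)
    rw [hfixm, sub_self, smul_eq_zero_iff_eq] at key
    exact (injective_iff_map_eq_zero _).mp (AddSubgroup.inclusion_injective _) _ key
  -- conclude: the restriction to `I_𝔓` is the class of the zero cocycle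
  have hmap : Literature.NumberTheory.EllipticCurves.resOfLe (W.geomTorsion (p : ℤ)) hle
      (oneCocycleClass _ φ) = oneCocycleClass _
      (contOneCocycles.pullback (subgroupInclusion hle)
        (resHomOfEquivariant (subgroupInclusion hle) (AddMonoidHom.id (W.geomTorsion (p : ℤ)))
          (fun _ _ ↦ rfl)) φ) :=
    map_oneCocycleClass _ _ _ φ
  rw [hmap, oneCocycleClass_eq_zero_iff]
  refine ⟨0, fun τ ↦ ?_⟩
  rw [contOneCocycles.pullback_apply, map_zero, sub_zero]
  exact hvan τ τ.2

end Unramified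

/-! ## (C′) Assembly: `Sel_𝔭^Σ(K_∞, E[p^∞])[𝔪]` is finite for finite `Σ` -/

section Assembly

variable {W p} [Fact p.Prime] (κ : ZpExtension K p) {𝔭 : HeightOneSpectrum (𝓞 K)}
  {S : Set (HeightOneSpectrum (𝓞 K))}

/-- **(C′) `Sel_𝔭^Σ(K_∞, E[p^∞])[𝔪]` is finite** for an elliptic curve `E/K` over a number field, a
`ℤ_p`-extension `κ` unramified outside `p` (`hIκ : I_𝔓 ≤ ker κ` for `𝔓 ∤ p`), a topological generator
`γ`, any distinguished prime `𝔭` and a FINITE set `Σ`: the set of `s ∈ Sel_𝔭^Σ(K_∞, E[p^∞])` with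
`p s = 0` and `conj_γ s = s` is finite. The assembly (C) of
`WeierstrassCurve.finite_setOf_selmerInfty_pTorsion_conjH1_eq` run verbatim with (B′)
(`resOfLe_eq_zero_of_mem_selmerOver`) in place of (B) and the finite set
`S' = {bad} ∪ {v ∣ p} ∪ Σ`: lift `s` to `y ∈ H¹(K_∞, E[p])` ((A), `exists_torsionToPrimaryH1Sub_eq`);
`y` is unramified outside `S'` (B′) and `conj_γ y − y` lies in the finite kernel `F₀` of (A)
(`finite_ker_torsionToPrimaryH1Sub`); such `y` form a finite union of translates of the finite set of
`γ`-invariant classes unramified outside `S'` (`finite_setOf_conjH1_eq_of_unramified_of`: descent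
into `H¹(G_K, E[p]; S')`, finite by Silverman X.4.3). Greenberg (1999), §1 p. 60 ("`X/𝔪X` is
finite"), here for Castella's Selmer group. [cite: GreenbergLNM1716, §1 p. 60 (after Conj. 1.3)] [cite: Castella2018, §2.1 (arXiv:1704.06608 p. 5), "easily shown to be a finitely generated `Λ`-module"] -/
theorem finite_setOf_selmerAc_pTorsion_conjH1_eq [W.IsElliptic]
    (hIκ : ∀ ⦃v : HeightOneSpectrum (𝓞 K)⦄, (p : 𝓞 K) ∉ v.asIdeal →
      ∀ ⦃𝔓 : Ideal (absIntegers (𝓞 K) K)⦄, 𝔓 ∈ v.primesAbove →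
        𝔓.inertia (absoluteGaloisGroup K) ≤ κ.kerSubgroup)
    {γ : absoluteGaloisGroup K} (hγ : κ.IsTopGenerator γ) (hS : S.Finite) :
    Set.Finite {s : selmerAc W p κ 𝔭 S |
      p • s = 0 ∧ W.conjH1 p κ.kerSubgroup γ (s : W.subgroupH1 p κ.kerSubgroup) = s} := by
  classical
  have hp := (Fact.out : p.Prime)
  -- notation
  let ιN := W.torsionToPrimaryH1Sub p κ.kerSubgroup
  -- the finite set of places `S' = {bad} ∪ {v ∣ p} ∪ Σ`
  let S' : Set (HeightOneSpectrum (𝓞 K)) :=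
    (W.badPlaces (𝓞 K) ∪ {v | ((p : ℤ) : 𝓞 K) ∈ v.asIdeal}) ∪ S
  have hbad : (W.badPlaces (𝓞 K)).Finite := W.finite_badPlaces_holds (𝓞 K)
  have hS' : S'.Finite := (hbad.union
    (WeierstrassCurve.finite_setOf_intCast_mem_asIdeal (by exact_mod_cast hp.ne_zero))).union hS
  have hSp : ∀ v : HeightOneSpectrum (𝓞 K), (p : 𝓞 K) ∈ v.asIdeal → v ∈ S' := fun v hv ↦
    Or.inl (Or.inr (by simpa using hv))
  -- unramified predicate on `H¹(N, E[p])`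
  let Unr : Literature.NumberTheory.EllipticCurves.subgroupH1 κ.kerSubgroup (W.geomTorsion (p : ℤ)) →
      Prop := fun x ↦
    ∀ v : HeightOneSpectrum (𝓞 K), v ∉ S' → ∀ 𝔓 ∈ v.primesAbove,
      ∀ hle : 𝔓.inertia (absoluteGaloisGroup K) ≤ κ.kerSubgroup,
        Literature.NumberTheory.EllipticCurves.resOfLe (W.geomTorsion (p : ℤ)) hle x = 0
  have hUnr_sub : ∀ x y, Unr x → Unr y → Unr (x - y) := fun x y hx hy v hv 𝔓 h𝔓 hle ↦ by
    rw [map_sub, hx v hv 𝔓 h𝔓 hle, hy v hv 𝔓 h𝔓 hle, sub_zero]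
  -- (D) the `γ`-invariant unramified classes are finite
  haveI : Finite (W.geomTorsion (p : ℤ)) :=
    W.finite_torsionPoints_holds (AlgebraicClosure K) (by exact_mod_cast hp.ne_zero)
  haveI : ContinuousSMul (absoluteGaloisGroup K) (W.geomTorsion (p : ℤ)) :=
    W.continuousSMul_geomTorsion (W.isOpen_stabilizer_point_holds) _
  have hpM : ∀ m : W.geomTorsion (p : ℤ), p • m = 0 := fun m ↦
    Subtype.ext (by rw [AddSubgroupClass.coe_nsmul, ZeroMemClass.coe_zero]; exact
      AddSubgroup.torsionBy.nsmul_iff.mp m.2)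
  have hA₀ := WeierstrassCurve.finite_setOf_conjH1_eq_of_unramified_of κ (M := W.geomTorsion (p : ℤ))
    hγ hpM (finite_h1Unramified_holds K) hIκ hS' hSp
  -- (A) the kernel of `ιN` is finite
  have hF₀ := W.finite_ker_torsionToPrimaryH1Sub p (H := κ.kerSubgroup)
    W.zsmul_geomPoints_surjective_holds
  -- the lifts: `L = {y | ιN y ∈ Sel, conj_γ (ιN y) = ιN y}` is finite
  have hL : Set.Finite {y : Literature.NumberTheory.EllipticCurves.subgroupH1 κ.kerSubgroup
      (W.geomTorsion (p : ℤ)) |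
      ιN y ∈ selmerAc W p κ 𝔭 S ∧ W.conjH1 p κ.kerSubgroup γ (ιN y) = ιN y} := by
    -- `L ⊆ ⋃_{f ∈ ker ιN} {y | Unr y ∧ conj_γ y - y = f}`
    have hsub : {y : Literature.NumberTheory.EllipticCurves.subgroupH1 κ.kerSubgroup
        (W.geomTorsion (p : ℤ)) |
        ιN y ∈ selmerAc W p κ 𝔭 S ∧ W.conjH1 p κ.kerSubgroup γ (ιN y) = ιN y} ⊆
        ⋃ f ∈ (ιN.ker : Set _), {y | Unr y ∧
          Literature.NumberTheory.EllipticCurves.conjH1 κ.kerSubgroup (W.geomTorsion (p : ℤ)) γ y -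
            y = f} := by
      rintro y ⟨hy1, hy2⟩
      simp only [Set.mem_iUnion, Set.mem_setOf_eq, SetLike.mem_coe, exists_prop]
      refine ⟨_, ?_, ?_, rfl⟩
      · rw [AddMonoidHom.mem_ker, map_sub, ← W.conjH1_torsionToPrimaryH1Sub, hy2, sub_self]
      · intro v hv 𝔓 h𝔓 hle
        have hv' : v ∉ W.badPlaces (𝓞 K) := fun h ↦ hv (Or.inl (Or.inl h))
        have hpv : (p : 𝓞 K) ∉ v.asIdeal := fun h ↦ hv (hSp v h)
        have hvS : v ∉ S := fun h ↦ hv (Or.inr h)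
        exact resOfLe_eq_zero_of_mem_selmerOver (H := κ.kerSubgroup) hy1 hv' hpv hvS h𝔓 hle
    refine (hF₀.biUnion fun f _ ↦ ?_).subset hsub
    -- each piece is empty or a translate of the finite set of (D)
    by_cases hne : {y | Unr y ∧
        Literature.NumberTheory.EllipticCurves.conjH1 κ.kerSubgroup (W.geomTorsion (p : ℤ)) γ y -
          y = f}.Nonempty
    · obtain ⟨y₀, hy₀U, hy₀⟩ := hne
      refine (hA₀.image fun a ↦ y₀ + a).subset ?_
      rintro y ⟨hyU, hy⟩
      refine ⟨y - y₀, ⟨?_, hUnr_sub y y₀ hyU hy₀U⟩, by abel⟩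
      rw [map_sub, sub_eq_iff_eq_add.mp hy, sub_eq_iff_eq_add.mp hy₀]
      abel
    · rw [Set.not_nonempty_iff_eq_empty.mp hne]
      exact Set.finite_empty
  -- conclusion: the target set is the preimage under the (injective) coercion of a subset of `ιN '' L`
  refine ((hL.image ιN).preimage (Subtype.val_injective.injOn)).subset ?_
  rintro s ⟨hs1, hs2⟩
  have hps : p • (s : W.subgroupH1 p κ.kerSubgroup) = 0 := by
    rw [← AddSubgroupClass.coe_nsmul, hs1, ZeroMemClass.coe_zero]
  obtain ⟨y, hy⟩ := W.exists_torsionToPrimaryH1Sub_eq p (H := κ.kerSubgroup)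
    W.zsmul_geomPoints_surjective_holds hps
  refine ⟨y, ⟨?_, ?_⟩, hy⟩
  · show ιN y ∈ selmerAc W p κ 𝔭 S
    rw [show ιN y = (s : W.subgroupH1 p κ.kerSubgroup) from hy]; exact s.2
  · show W.conjH1 p κ.kerSubgroup γ (ιN y) = ιN y
    rw [show ιN y = (s : W.subgroupH1 p κ.kerSubgroup) from hy]; exact hs2

/-- **`Sel_𝔭^Σ(K_∞, E[p^∞])[𝔪]` is finite — UNCONDITIONALLY**, for every elliptic curve over a number
field, every `ℤ_p`-extension `κ` (in particular the anticyclotomic `ℤ_p`-extension of an imaginary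
quadratic field), every topological generator `γ`, every `𝔭` and every finite `Σ`: the hypothesis
`hIκ` of (C′) is the tree's PROVED `ZpExtension.inertia_le_kerSubgroup_holds` (`ℤ_p`-extensions are
unramified outside `p`; Washington Prop. 13.2, proved in `ZpExtensionUnramifiedProofs` without class
field theory). This is the input of Nakayama's lemma for `X_ac^Σ(E[p^∞])`
(`XAc.module_finite_of_finite`, `AnticyclotomicDualPair.lean`).
[cite: GreenbergLNM1716, §1 p. 60 (after Conj. 1.3)] [cite: Washington1997, Prop. 13.2] -/
theorem finite_selmerAc_pTorsion_invariants [W.IsElliptic] {γ : absoluteGaloisGroup K}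
    (hγ : κ.IsTopGenerator γ) (hS : S.Finite) :
    Set.Finite {s : selmerAc W p κ 𝔭 S |
      p • s = 0 ∧ W.conjH1 p κ.kerSubgroup γ (s : W.subgroupH1 p κ.kerSubgroup) = s} :=
  finite_setOf_selmerAc_pTorsion_conjH1_eq κ
    (fun _ hv _ h𝔓 ↦ ZpExtension.inertia_le_kerSubgroup_holds K p κ hv h𝔓) hγ hS

/-- The case `Σ = ∅` of route R1 (Castella's `Sel_𝔭(K_∞, E[p^∞])` proper): `Sel_𝔭(K_∞, E[p^∞])[𝔪]`
is finite. [cite: GreenbergLNM1716, §1 p. 60 (after Conj. 1.3)] -/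
theorem finite_selmerAc_empty_pTorsion_invariants [W.IsElliptic] {γ : absoluteGaloisGroup K}
    (hγ : κ.IsTopGenerator γ) :
    Set.Finite {s : selmerAc W p κ 𝔭 ∅ |
      p • s = 0 ∧ W.conjH1 p κ.kerSubgroup γ (s : W.subgroupH1 p κ.kerSubgroup) = s} :=
  finite_selmerAc_pTorsion_invariants κ hγ Set.finite_empty

end Assembly

/-! ## `X_ac^Σ(E[p^∞])` is a finitely generated `Λ`-module -/

section ModuleFinite

variable {W p} [Fact p.Prime] (κ : ZpExtension K p) (𝔭 : HeightOneSpectrum (𝓞 K))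
  (S : Set (HeightOneSpectrum (𝓞 K))) (γ : absoluteGaloisGroup K) [hγ : Fact (κ.IsTopGenerator γ)]

/-- **`X_ac^Σ(E[p^∞])` is a finitely generated `Λ = ℤ_p⟦T⟧`-module** for finite `Σ` — Castella's
"which is easily shown to be a finitely generated `Λ`-module" (Cas18 §2.1) as a THEOREM about the
constructed module `XAc W p κ 𝔭 S γ`, for every elliptic curve over a number field, every
`ℤ_p`-extension `κ` (in particular the anticyclotomic one), every topological generator `γ` and every
`𝔭`: Nakayama for the dual pair (`XAc.module_finite_of_finite`) and the finiteness of `Sel[𝔪]`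
(`finite_selmerAc_pTorsion_invariants`).
[cite: Castella2018, §2.1 (arXiv:1704.06608 p. 5), "easily shown to be a finitely generated `Λ`-module"] [cite: GreenbergLNM1716, §1 p. 60 (after Conj. 1.3)] -/
theorem XAc.module_finite [W.IsElliptic] (hS : S.Finite) :
    Module.Finite (IwasawaAlgebra p) (XAc W p κ 𝔭 S γ) :=
  XAc.module_finite_of_finite W p κ 𝔭 S γ (finite_selmerAc_pTorsion_invariants κ hγ.out hS)

/-- **`X_ac(E[p^∞]) = X_ac^∅(E[p^∞])` is a finitely generated `Λ`-module** (route R1's case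
`Σ = ∅`). [cite: Castella2018, §2.1 (arXiv:1704.06608 p. 5)] -/
theorem XAc.module_finite_empty [W.IsElliptic] :
    Module.Finite (IwasawaAlgebra p) (XAc W p κ 𝔭 ∅ γ) :=
  XAc.module_finite κ 𝔭 ∅ γ Set.finite_empty

end ModuleFinite

end Summit.BirchSwinnertonDyer.Rank1Residual.X11b.AcSelmer

end
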